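import Literature.NumberTheory.DiophantineGeometry.SimplestQuarticThueRoots

/-!
# The simplest quartic Thue equations: the constants of [ChenVoutier1997, §3.1] (towards Thm 5)

Proved companions of the named fact `SimplestQuarticThueSolutions` ([ChenVoutier1997, Thm 3]):
the elementary numerical facts that the proof of the irrationality measure [ChenVoutier1997, Thm 5]
invokes once the hypergeometric Lemmas 1–6 have produced the approximations, namely
(`ε = (t + √(t² + 16))/4` as in `SimplestQuarticThueRoots`, i.e. `ε > 0`, `ε − 1/ε = t/2`):

* the Gamma-function estimate behind (3.13):
  `Γ(r + 3/4) Γ(r + 5/4) / (2 Γ(3/4) Γ(1/4) (r!)²) ≤ 1/8` for all `r ≥ 0` (`gamma_ratio_le`; equality at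
  `r = 0`, the ratio decreasing in `r`);
* the moduli entering `E = ε/8`, `Q = 8ε`: `√(t² + 16) = 4ε − t` (`sqrt_sq_add_sixteen`), and with
  `√w = (t + 4i)/√(t² + 16)`, `u' = −it − 4`: `(√w)² = w = (t² − 16)/(t² + 16) + 8ti/(t² + 16)`,
  `|u'|² = t² + 16`, `|1 + √w|² = 2 + 2t/√(t² + 16)`, `|1 − √w|² = 2 − 2t/√(t² + 16)`, hence
  `|u'|·|1 + √w|² = 8ε` and `|u'|·|1 − √w|² = 8/ε` (`normSq_sqrtw_…`, `abs_u_mul_…`);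
* for `t ≥ 128`: `ε > 64`, so `κ = log(8ε)/log(ε/8)` satisfies `1 < κ < 3` (`one_lt_kappa`,
  `kappa_lt_three` — the threshold `ε > 64 ⟺ κ < 3` is why the printed proof needs `t ≥ 128`), and the
  four numerical claims of the proof of Thm 5: `|1 + √w|² > 3.999`, `2 l₀ E < 0.4` with
  `l₀ = πt/(16 + t²)`, `E = ε/8`; `2 k₀ Q = 16.008 ε < 8.01 t` with `k₀ = 1.0005`, `Q = 8ε`; and
  `1/(2 l₀) < 0.16 t`.

No hypergeometric input is formalised here (Lemmas 1–6 of [ChenVoutier1997, §2] remain the missing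
apex); this file only discharges the arithmetic the printed proof states without proof.

## References

* Chen Jian Hua, P. M. Voutier, J. Number Theory 62 (1997) 71–99 = arXiv:1401.5450, §3.1 and the
  proof of Thm 5. [ChenVoutier1997]
-/

noncomputable section

namespace Literature.NumberTheory.DiophantineGeometry

namespace SimplestQuarticThue

open Real

/-! ## The Gamma-function estimate behind (3.13) -/

/-- `Γ(r + 3/4) Γ(r + 5/4)/(r!)²` is non-increasing in `r`, hence `≤ Γ(3/4) Γ(5/4)`.
[cite: ChenVoutier1997, §3.1 (3.13)] -/
theorem gamma_prod_div_factorial_sq_le (r : ℕ) :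
    Real.Gamma ((r : ℝ) + 3 / 4) * Real.Gamma ((r : ℝ) + 5 / 4) / ((r.factorial : ℝ) ^ 2) ≤
      Real.Gamma (3 / 4) * Real.Gamma (5 / 4) := by
  induction r with
  | zero => simp
  | succ n ih =>
    have hG3 : 0 < Real.Gamma ((n : ℝ) + 3 / 4) := Real.Gamma_pos_of_pos (by positivity)
    have hG5 : 0 < Real.Gamma ((n : ℝ) + 5 / 4) := Real.Gamma_pos_of_pos (by positivity)
    have h1 : Real.Gamma (((n + 1 : ℕ) : ℝ) + 3 / 4) = ((n : ℝ) + 3 / 4) * Real.Gamma ((n : ℝ) + 3 / 4) := by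
      rw [show (((n + 1 : ℕ) : ℝ) + 3 / 4) = ((n : ℝ) + 3 / 4) + 1 by push_cast; ring]
      exact Real.Gamma_add_one (by positivity)
    have h2 : Real.Gamma (((n + 1 : ℕ) : ℝ) + 5 / 4) = ((n : ℝ) + 5 / 4) * Real.Gamma ((n : ℝ) + 5 / 4) := by
      rw [show (((n + 1 : ℕ) : ℝ) + 5 / 4) = ((n : ℝ) + 5 / 4) + 1 by push_cast; ring]
      exact Real.Gamma_add_one (by positivity)
    have h3 : (((n + 1).factorial : ℕ) : ℝ) = ((n : ℝ) + 1) * (n.factorial : ℝ) := by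
      rw [Nat.factorial_succ]; push_cast; ring
    have hf : 0 < (n.factorial : ℝ) := by exact_mod_cast Nat.factorial_pos n
    rw [h1, h2, h3]
    have e : ((n : ℝ) + 3 / 4) * Real.Gamma ((n : ℝ) + 3 / 4) * (((n : ℝ) + 5 / 4) *
        Real.Gamma ((n : ℝ) + 5 / 4)) / ((((n : ℝ) + 1) * (n.factorial : ℝ)) ^ 2) =
        (((n : ℝ) + 3 / 4) * ((n : ℝ) + 5 / 4) / ((n : ℝ) + 1) ^ 2) *
          (Real.Gamma ((n : ℝ) + 3 / 4) * Real.Gamma ((n : ℝ) + 5 / 4) / ((n.factorial : ℝ) ^ 2)) := by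
      field_simp
    rw [e]
    have hratio : ((n : ℝ) + 3 / 4) * ((n : ℝ) + 5 / 4) / ((n : ℝ) + 1) ^ 2 ≤ 1 := by
      rw [div_le_one (by positivity)]; nlinarith
    have hnonneg : 0 ≤ Real.Gamma ((n : ℝ) + 3 / 4) * Real.Gamma ((n : ℝ) + 5 / 4) /
        ((n.factorial : ℝ) ^ 2) := by positivity
    calc _ ≤ 1 * (Real.Gamma ((n : ℝ) + 3 / 4) * Real.Gamma ((n : ℝ) + 5 / 4) /
          ((n.factorial : ℝ) ^ 2)) := mul_le_mul_of_nonneg_right hratio hnonneg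
      _ ≤ _ := by rw [one_mul]; exact ih

/-- **(3.13)'s constant**: `Γ(r + 3/4) Γ(r + 5/4) / (2 Γ(3/4) Γ(1/4) (r!)²) ≤ 1/8` for every `r ≥ 0`
(equality at `r = 0` since `Γ(5/4) = Γ(1/4)/4`). [cite: ChenVoutier1997, §3.1 (3.13)] -/
theorem gamma_ratio_le (r : ℕ) :
    Real.Gamma ((r : ℝ) + 3 / 4) * Real.Gamma ((r : ℝ) + 5 / 4) /
        (2 * Real.Gamma (3 / 4) * Real.Gamma (1 / 4) * (r.factorial : ℝ) ^ 2) ≤ 1 / 8 := by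
  have hG3 : 0 < Real.Gamma (3 / 4 : ℝ) := Real.Gamma_pos_of_pos (by norm_num)
  have hG1 : 0 < Real.Gamma (1 / 4 : ℝ) := Real.Gamma_pos_of_pos (by norm_num)
  have hf : 0 < (r.factorial : ℝ) := by exact_mod_cast Nat.factorial_pos r
  have h5 : Real.Gamma (5 / 4 : ℝ) = 1 / 4 * Real.Gamma (1 / 4) := by
    rw [show (5 / 4 : ℝ) = 1 / 4 + 1 by norm_num]
    exact Real.Gamma_add_one (by norm_num)
  have h := gamma_prod_div_factorial_sq_le r
  rw [h5] at h
  rw [div_le_iff₀ (by positivity)]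
  rw [div_le_iff₀ (by positivity)] at h
  nlinarith

/-! ## `√(t² + 16) = 4ε − t` and the moduli `|u'|·|1 ± √w|² = 8ε^{±1}` -/

variable {t ε : ℝ}

/-- `√(t² + 16) = 4ε − t` (`= 2ε + 2/ε > 0`). [cite: ChenVoutier1997, §3] -/
theorem sqrt_sq_add_sixteen (hε : 0 < ε) (h : ε - ε⁻¹ = t / 2) :
    Real.sqrt (t ^ 2 + 16) = 4 * ε - t := by
  have h2 := eps_sq hε h
  have e : 4 * ε - t = 2 * ε + 2 * ε⁻¹ := by linarith
  have hpos : 0 < 4 * ε - t := by rw [e]; positivity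
  rw [Real.sqrt_eq_iff_mul_self_eq_of_pos hpos]
  linear_combination 16 * h2

/-- With `s = √(t² + 16)`: `2s + 2t = 8ε`. [cite: ChenVoutier1997, §3.1] -/
theorem two_sqrt_add_two_eq (hε : 0 < ε) (h : ε - ε⁻¹ = t / 2) :
    2 * Real.sqrt (t ^ 2 + 16) + 2 * t = 8 * ε := by
  rw [sqrt_sq_add_sixteen hε h]; ring

/-- With `s = √(t² + 16)`: `2s − 2t = 8/ε`. [cite: ChenVoutier1997, §3.1] -/
theorem two_sqrt_sub_two_eq (hε : 0 < ε) (h : ε - ε⁻¹ = t / 2) :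
    2 * Real.sqrt (t ^ 2 + 16) - 2 * t = 8 / ε := by
  rw [sqrt_sq_add_sixteen hε h]
  have ht : t = 2 * ε - 2 * ε⁻¹ := by linarith
  rw [ht, div_eq_mul_inv]; ring

/-- `√w := (t + 4i)/√(t² + 16)` squares to `w = (t² − 16)/(t² + 16) + 8ti/(t² + 16)`
(`= z(0)/u(0)`, §3.1). [cite: ChenVoutier1997, §3.1] -/
theorem sqrtw_sq (t : ℝ) :
    (⟨t / Real.sqrt (t ^ 2 + 16), 4 / Real.sqrt (t ^ 2 + 16)⟩ : ℂ) ^ 2 =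
      ⟨(t ^ 2 - 16) / (t ^ 2 + 16), 8 * t / (t ^ 2 + 16)⟩ := by
  have hs : Real.sqrt (t ^ 2 + 16) * Real.sqrt (t ^ 2 + 16) = t ^ 2 + 16 :=
    Real.mul_self_sqrt (by positivity)
  apply Complex.ext
  · rw [sq, Complex.mul_re]
    dsimp only
    rw [div_mul_div_comm, div_mul_div_comm, ← sub_div, hs]
    ring
  · rw [sq, Complex.mul_im]
    dsimp only
    rw [div_mul_div_comm, div_mul_div_comm, ← add_div, hs]
    ring

/-- `√w` lies on the unit circle: `|√w|² = 1`. [cite: ChenVoutier1997, §3.1] -/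
theorem normSq_sqrtw (t : ℝ) :
    Complex.normSq (⟨t / Real.sqrt (t ^ 2 + 16), 4 / Real.sqrt (t ^ 2 + 16)⟩ : ℂ) = 1 := by
  have hs : Real.sqrt (t ^ 2 + 16) ^ 2 = t ^ 2 + 16 := Real.sq_sqrt (by positivity)
  have hs0 : Real.sqrt (t ^ 2 + 16) ≠ 0 := (Real.sqrt_pos.2 (by positivity)).ne'
  rw [Complex.normSq_mk]
  field_simp
  nlinarith [hs]

/-- `|u'|² = |−it − 4|² = t² + 16`. [cite: ChenVoutier1997, §3.1] -/
theorem normSq_u' (t : ℝ) : Complex.normSq (⟨-4, -t⟩ : ℂ) = t ^ 2 + 16 := by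
  rw [Complex.normSq_mk]; ring

/-- `|1 + √w|² = 2 + 2t/√(t² + 16)`. [cite: ChenVoutier1997, §3.1] -/
theorem normSq_one_add_sqrtw (t : ℝ) :
    Complex.normSq (1 + ⟨t / Real.sqrt (t ^ 2 + 16), 4 / Real.sqrt (t ^ 2 + 16)⟩ : ℂ) =
      2 + 2 * t / Real.sqrt (t ^ 2 + 16) := by
  have hs : Real.sqrt (t ^ 2 + 16) ^ 2 = t ^ 2 + 16 := Real.sq_sqrt (by positivity)
  have hs0 : Real.sqrt (t ^ 2 + 16) ≠ 0 := (Real.sqrt_pos.2 (by positivity)).ne'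
  rw [show (1 + ⟨t / Real.sqrt (t ^ 2 + 16), 4 / Real.sqrt (t ^ 2 + 16)⟩ : ℂ) =
      ⟨1 + t / Real.sqrt (t ^ 2 + 16), 4 / Real.sqrt (t ^ 2 + 16)⟩ by
    apply Complex.ext <;> simp, Complex.normSq_mk]
  field_simp
  nlinarith [hs]

/-- `|1 − √w|² = 2 − 2t/√(t² + 16)`. [cite: ChenVoutier1997, §3.1] -/
theorem normSq_one_sub_sqrtw (t : ℝ) :
    Complex.normSq (1 - ⟨t / Real.sqrt (t ^ 2 + 16), 4 / Real.sqrt (t ^ 2 + 16)⟩ : ℂ) =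
      2 - 2 * t / Real.sqrt (t ^ 2 + 16) := by
  have hs : Real.sqrt (t ^ 2 + 16) ^ 2 = t ^ 2 + 16 := Real.sq_sqrt (by positivity)
  have hs0 : Real.sqrt (t ^ 2 + 16) ≠ 0 := (Real.sqrt_pos.2 (by positivity)).ne'
  rw [show (1 - ⟨t / Real.sqrt (t ^ 2 + 16), 4 / Real.sqrt (t ^ 2 + 16)⟩ : ℂ) =
      ⟨1 - t / Real.sqrt (t ^ 2 + 16), -(4 / Real.sqrt (t ^ 2 + 16))⟩ by
    apply Complex.ext <;> simp, Complex.normSq_mk]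
  field_simp
  nlinarith [hs]

/-- **`|u'|·|1 + √w|² = 8ε`** — the growth `Q = 8ε` of the approximants ((3.12)).
[cite: ChenVoutier1997, §3.1 (3.12)] -/
theorem abs_u_mul_normSq_one_add_sqrtw (hε : 0 < ε) (h : ε - ε⁻¹ = t / 2) :
    Real.sqrt (t ^ 2 + 16) * (2 + 2 * t / Real.sqrt (t ^ 2 + 16)) = 8 * ε := by
  have hs0 : Real.sqrt (t ^ 2 + 16) ≠ 0 := (Real.sqrt_pos.2 (by positivity)).ne'
  rw [mul_add, mul_div_cancel₀ _ hs0]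
  linarith [two_sqrt_add_two_eq hε h]

/-- **`|u'|·|1 − √w|² = 8/ε`** — the decay `E = ε/8` of the remainders ((3.13)).
[cite: ChenVoutier1997, §3.1 (3.13)] -/
theorem abs_u_mul_normSq_one_sub_sqrtw (hε : 0 < ε) (h : ε - ε⁻¹ = t / 2) :
    Real.sqrt (t ^ 2 + 16) * (2 - 2 * t / Real.sqrt (t ^ 2 + 16)) = 8 / ε := by
  have hs0 : Real.sqrt (t ^ 2 + 16) ≠ 0 := (Real.sqrt_pos.2 (by positivity)).ne'
  rw [mul_sub, mul_div_cancel₀ _ hs0]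
  linarith [two_sqrt_sub_two_eq hε h]

/-! ## `t ≥ 128`: `ε > 64`, `1 < κ < 3`, and the four numerical claims of the proof of Thm 5 -/

/-- For `t ≥ 128`, `ε > 64` (as `ε > t/2`). [cite: ChenVoutier1997, §3.1] -/
theorem eps_gt (hε : 0 < ε) (h : ε - ε⁻¹ = t / 2) (ht : 128 ≤ t) : 64 < ε := by
  have := (eps_bounds hε h (by linarith)).1
  linarith

/-- `κ = log(8ε)/log(ε/8) > 1` once `ε > 8` (numerator `>` denominator `> 0`).
[cite: ChenVoutier1997, Thm 5] -/
theorem one_lt_kappa (hε8 : 8 < ε) : 1 < Real.log (8 * ε) / Real.log (ε / 8) := by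
  have hden : 0 < Real.log (ε / 8) := Real.log_pos (by rw [lt_div_iff₀ (by norm_num)]; linarith)
  rw [lt_div_iff₀ hden, one_mul]
  exact Real.log_lt_log (by positivity) (by linarith)

/-- **`κ = log(8ε)/log(ε/8) < 3 ⟺ ε > 64`** (`8ε < (ε/8)³ ⟺ ε² > 4096`): the threshold that makes
the printed proof work exactly for `t ≥ 128`. [cite: ChenVoutier1997, Thm 5 and §3.2] -/
theorem kappa_lt_three (hε : 64 < ε) : Real.log (8 * ε) / Real.log (ε / 8) < 3 := by
  have hden : 0 < Real.log (ε / 8) := Real.log_pos (by rw [lt_div_iff₀ (by norm_num)]; linarith)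
  rw [div_lt_iff₀ hden]
  have h3 : 3 * Real.log (ε / 8) = Real.log ((ε / 8) ^ 3) := by
    rw [Real.log_pow]; norm_num
  rw [h3]
  apply Real.log_lt_log (by positivity)
  have : (ε / 8) ^ 3 = ε * ε ^ 2 / 512 := by ring
  rw [this, lt_div_iff₀ (by norm_num)]
  nlinarith [mul_pos (by linarith : (0 : ℝ) < ε) (by nlinarith : (0 : ℝ) < ε ^ 2 - 4096)]

/-- `|1 + √w|² = 2 + 2t/√(t² + 16) > 3.999` for `t ≥ 128`. [cite: ChenVoutier1997, §3.1 (before (3.12))] -/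
theorem normSq_one_add_sqrtw_gt (ht : 128 ≤ t) :
    3999 / 1000 < 2 + 2 * t / Real.sqrt (t ^ 2 + 16) := by
  have hs : Real.sqrt (t ^ 2 + 16) ^ 2 = t ^ 2 + 16 := Real.sq_sqrt (by positivity)
  have hs0 : 0 < Real.sqrt (t ^ 2 + 16) := Real.sqrt_pos.2 (by positivity)
  have ht0 : 0 < t := by linarith
  have key : 1999 / 2000 * Real.sqrt (t ^ 2 + 16) < t := by
    by_contra hc
    push Not at hc
    nlinarith [mul_nonneg (sub_nonneg.2 hc)
      (by positivity : (0 : ℝ) ≤ 1999 / 2000 * Real.sqrt (t ^ 2 + 16) + t),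
      mul_nonneg (sub_nonneg.2 ht) ht0.le]
  have : 2 * (1999 / 2000) < 2 * t / Real.sqrt (t ^ 2 + 16) := by
    rw [lt_div_iff₀ hs0]; linarith
  linarith

/-- `2 l₀ E < 0.4` with `l₀ = πt/(16 + t²)`, `E = ε/8`, for `t ≥ 128` (indeed for `t ≥ 5`).
[cite: ChenVoutier1997, proof of Thm 5] -/
theorem two_l0_E_lt (hε : 0 < ε) (h : ε - ε⁻¹ = t / 2) (ht : 128 ≤ t) :
    2 * (Real.pi * t / (16 + t ^ 2)) * (ε / 8) < 2 / 5 := by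
  have ht0 : 0 < t := by linarith
  obtain ⟨-, he2⟩ := eps_bounds hε h ht0
  have hpi := Real.pi_lt_d2
  have h1 : 2 * (Real.pi * t / (16 + t ^ 2)) * (ε / 8) = Real.pi * (t * ε) / 4 / (16 + t ^ 2) := by
    ring
  rw [h1, div_lt_iff₀ (by positivity)]
  have hte : t * ε < t ^ 2 / 2 + 2 := by
    have := mul_lt_mul_of_pos_left he2 ht0
    have e : t * (t / 2 + 2 / t) = t ^ 2 / 2 + 2 := by field_simp
    linarith
  norm_num at hpi
  nlinarith [mul_lt_mul_of_pos_left hte Real.pi_pos, Real.pi_pos]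

/-- `2 k₀ Q = 2 · 1.0005 · 8ε = 16.008 ε < 8.01 t` for `t ≥ 128`. [cite: ChenVoutier1997, proof of Thm 5] -/
theorem two_k0_Q_lt (hε : 0 < ε) (h : ε - ε⁻¹ = t / 2) (ht : 128 ≤ t) :
    2 * (2001 / 2000) * (8 * ε) < 801 / 100 * t := by
  have ht0 : 0 < t := by linarith
  obtain ⟨-, he2⟩ := eps_bounds hε h ht0
  have : 2 / t ≤ 2 / 128 := div_le_div_of_nonneg_left (by norm_num) (by norm_num) ht
  linarith

/-- `1/(2 l₀) = (16 + t²)/(2πt) < 0.16 t` for `t ≥ 128` (indeed for `t ≥ 58`).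
[cite: ChenVoutier1997, proof of Thm 5] -/
theorem inv_two_l0_lt (ht : 128 ≤ t) : (16 + t ^ 2) / (2 * Real.pi * t) < 4 / 25 * t := by
  have ht0 : 0 < t := by linarith
  have hpi := Real.pi_gt_d2
  norm_num at hpi
  rw [div_lt_iff₀ (by positivity)]
  nlinarith [mul_le_mul_of_nonneg_left ht ht0.le, mul_pos Real.pi_pos ht0]

end SimplestQuarticThue

end Literature.NumberTheory.DiophantineGeometry
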